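import Summits.ResolutionOfSingularities.ResolutionOfSingularities.Theorems.EquisingularLiftEquisingularLiftWittRing
import Summits.ResolutionOfSingularities.ResolutionOfSingularities.Theorems.EquisingularLiftEquisingularLiftProjectiveAmbientFibre
import Literature.AlgebraicGeometry.Motives.ProjBaseChangeAny
import Mathlib.RingTheory.Localization.Away.Basic
import Mathlib.RingTheory.PrincipalIdealDomain
import HarnessLib

/-!
# EL♮(3), D18 «DESCENT-CERTIFICATE door», engine pieces (E0)+(E1): THE DESCENT BASE `ℤ[1/N] → 𝕎(k) → k` AND ITS THREE FIBRE SQUARES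

Sub-problem `ResolutionOfSingularities`, crux `EquisingularLiftNatThree` (`stmt-ResolutionOfSingularities-20148`), line W4.5(b) (L1 RESCUE),
desk R88-PRE (D18; idea-2 g32's `D18-LETTERS-idea2.md` v1.2/v1.3 §2 (E0) «choose `O` … `IsLocalization.Away` lift» and (E1) «`ℙⁿ_O = ℙⁿ_B ×_B Spec O`,
`ℙⁿ_k = ℙⁿ_B ×_B Spec k`, one `exact` per square»; res-type-027's letters `DescDoorOver B` (DefsE10 rev2 794d249e95b33744 :70) quantify
`∀ (θ : B →+* k) (φ) (hφ'), (∀ t, φ t = MvPolynomial.map θ t) → IsPullback (Proj.map φ hφ') q_k q_B (Spec.map (ofHom θ)) → …`).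
Supplier for res-L1-w45b-nose-w1's engine `descDoor_elnat`; Mathlib + ✓ `stub_wittRing` + ✓ `ProjectiveAmbientFibre.isPullback_projMap`
(π surjective) + ✓ `Literature…ProjBaseChangeRing.isPullback_projMap'` (any algebra).

Content:
* §1 (E0) `DescBase.ker_eq_maximalIdeal` / `isUnit_of_map_ne_zero` / ★ `exists_base` — for a characteristic-zero DVR `O` and ANY ring map
  `π : O →+* k` to a field of characteristic `p > 0`, `ker π = 𝔪_O`; hence `π x ≠ 0 → IsUnit x`; hence for `(N : k) ≠ 0` the Witt base
  `(O, π)` has `IsUnit (N : O)` and every `ℤ[1/N] →+* k` factors through `π` (`ℤ[1/N] := Localization.Away (N : ℤ)`).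
* §2 (E1) ★★ `DescBase.exists_base_squares` — the same base together with, for EVERY graded lift `φ` of `π` (the φ-idiom of ✓ `ELNatConclusionO`),
  ring maps `θ : ℤ[1/N] →+* k`, `η : ℤ[1/N] →+* O` with `π ∘ η = θ`, graded lifts `ψ` of `θ` and `χ` of `η` with
  `Proj.map ψ = Proj.map φ ≫ Proj.map χ` (Mathlib `Proj.map_comp`), and the THREE cartesian squares
  `ℙⁿ_k = ℙⁿ_O ×_O k` (over `Spec π`), `ℙⁿ_O = ℙⁿ_B ×_B O` (over `Spec η`), `ℙⁿ_k = ℙⁿ_B ×_B k` (over `Spec θ`, the paste) —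
  the last is LITERALLY the square hypothesis of `DescDoorOver ℤ[1/N]` at `(θ, ψ)`, the second is the `HX` of
  ✓ `CentreSeq.isPullback_comap_specMap_of_exceptionalFlatOver` with `E := O` (after `letI := η.toAlgebra`).

[OURS · res-L1-w45b-stub-2 g21 · def-free · standard axioms · `--supports stmt-ResolutionOfSingularities-20148 --as helper`, counted 0 ·
EL♮(3) NOT proved; resolution in char p NOT proved; nothing of [Hironaka2017] (a candidate under adjudication) is asserted. AI-written.]
-/

set_option linter.dupNamespace false -- mandated namespace `Summit.<Summit>.<Problem>` of this single-conjunct summit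
set_option linter.overlappingInstances false -- signatures carry `[IsDomain O] [IsDiscreteValuationRing O]`

noncomputable section

open CategoryTheory CategoryTheory.Limits AlgebraicGeometry IsLocalRing
open MvPolynomial
open Literature.AlgebraicGeometry.Motives
open Summit.ResolutionOfSingularities.ResolutionOfSingularities.Cruxes.EquisingularLift.StrataSplit

namespace Summit.ResolutionOfSingularities.ResolutionOfSingularities.Cruxes.EquisingularLiftNat.Sections.DescBase

/-! ## §1 (E0) the base -/

/-- For a characteristic-zero DVR `O` and a ring map `π : O →+* k` to a field of characteristic `p > 0`, the kernel of `π` is the maximal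
ideal: it is prime (the target is a domain), nonzero (`π p = 0` while `(p : O) ≠ 0`), hence maximal (nonzero primes of a PID are maximal),
hence `𝔪_O` (a local ring has one maximal ideal). [OURS · elementary] -/
theorem ker_eq_maximalIdeal {O k : Type*} [CommRing O] [IsDomain O] [IsDiscreteValuationRing O] [CharZero O] [Field k]
    {p : ℕ} (hp : p.Prime) [CharP k p] (π : O →+* k) : RingHom.ker π = maximalIdeal O := by
  have hprime : (RingHom.ker π).IsPrime := RingHom.ker_isPrime π
  have hne : RingHom.ker π ≠ ⊥ := by
    intro h
    have hmem : (p : O) ∈ RingHom.ker π := by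
      rw [RingHom.mem_ker, map_natCast, CharP.cast_eq_zero]
    rw [h, Ideal.mem_bot] at hmem
    exact (Nat.cast_ne_zero.mpr hp.ne_zero) hmem
  have hmax : (RingHom.ker π).IsMaximal := IsPrime.to_maximal_ideal hne
  exact IsLocalRing.eq_maximalIdeal hmax

/-- In the same situation an element with nonzero image under `π` is a unit of `O`. [OURS · elementary] -/
theorem isUnit_of_map_ne_zero {O k : Type*} [CommRing O] [IsDomain O] [IsDiscreteValuationRing O] [CharZero O] [Field k]
    {p : ℕ} (hp : p.Prime) [CharP k p] (π : O →+* k) {x : O} (hx : π x ≠ 0) : IsUnit x := by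
  by_contra h
  have hmem : x ∈ maximalIdeal O := (IsLocalRing.mem_maximalIdeal x).mpr h
  rw [← ker_eq_maximalIdeal hp π, RingHom.mem_ker] at hmem
  exact hx hmem

/-- ★ **(E0) THE DESCENT BASE.** Over an algebraically closed field `k` of characteristic `p > 0`, for every `N` with `(N : k) ≠ 0` there is a
complete characteristic-zero DVR `O` (the Witt ring, ✓ `stub_wittRing`) with algebraically closed residue field and a SURJECTIVE ring map
`π : O ↠ k` whose kernel is `𝔪_O`, in which `N` is a unit, and through which EVERY ring map `ℤ[1/N] →+* k` factors:
`∀ φk, ∃ φO : ℤ[1/N] →+* O, π ∘ φO = φk` (`ℤ[1/N] = Localization.Away (N : ℤ)`).  This is the triangle `B → O → k` of D18-LETTERS §2 (E0).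
[OURS · counted 0] -/
theorem exists_base (p : ℕ) (hp : p.Prime) (k : Type) [Field k] [CharP k p] [IsAlgClosed k] (N : ℕ) (hN : (N : k) ≠ 0) :
    ∃ (O : Type) (_ : CommRing O) (_ : IsDomain O) (_ : IsDiscreteValuationRing O) (_ : CharZero O)
      (_ : IsAdicComplete (maximalIdeal O) O) (_ : IsAlgClosed (ResidueField O)) (π : O →+* k),
      Function.Surjective π ∧ RingHom.ker π = maximalIdeal O ∧ IsUnit (N : O) ∧
      ∀ φk : Localization.Away (N : ℤ) →+* k, ∃ φO : Localization.Away (N : ℤ) →+* O, π.comp φO = φk := by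
  obtain ⟨O, i1, i2, i3, i4, i5, i6, π, hπ⟩ := stub_wittRing p hp k
  have hunit : IsUnit (N : O) := by
    refine isUnit_of_map_ne_zero hp π ?_
    rwa [map_natCast]
  refine ⟨O, i1, i2, i3, i4, i5, i6, π, hπ, ker_eq_maximalIdeal hp π, hunit, fun φk => ?_⟩
  have hunit' : IsUnit (algebraMap ℤ O (N : ℤ)) := by simpa using hunit
  refine ⟨IsLocalization.Away.lift (N : ℤ) hunit', ?_⟩
  refine IsLocalization.ringHom_ext (Submonoid.powers (N : ℤ)) ?_
  exact Subsingleton.elim _ _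

/-! ## §2 (E1) the three fibre squares (GENERIC base ring `B`; instantiate `B := ℤ[1/N]`, `η` from `exists_base`) -/

/-- ★★ **(E1) THE THREE FIBRE SQUARES OF A BASE `B → O ↠ k`.** For ring maps `η : B →+* O` and `π : O ↠ k` (surjective) and EVERY graded
`φ : O[x] → k[x]` with `φ = MvPolynomial.map π` pointwise (the φ-idiom of ✓ `ELNatConclusionO`, with its `hφ'`): graded `ψ : B[x] → k[x]` over
`θ := π ∘ η` and `χ : B[x] → O[x]` over `η` with `Proj.map ψ = Proj.map φ ≫ Proj.map χ`, and the three cartesian squares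
`(Proj.map φ, q_k, q_O, Spec π)`, `(Proj.map χ, q_O, q_B, Spec η)`, `(Proj.map ψ, q_k, q_B, Spec (π ∘ η))`,
`q_R := Proj.toSpecZero _ ≫ Spec.map (ofHom (algebraMap R (R[x]₀)))` as in the letters (`DescDoorOver B` rev2 :70 square hypothesis = the third,
at `θ := π ∘ η`; ✓ `CentreSeq.isPullback_comap_specMap_of_exceptionalFlatOver`'s `HX` with `E := O` = the second after `letI := η.toAlgebra`).
Proof: `χ := mapGraded B O` for `η.toAlgebra`, `ψ := φ ∘ χ` (`MvPolynomial.map_map`); ✓ `ProjectiveAmbientFibre.isPullback_projMap`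
(π surjective), ✓ `ProjBaseChangeRing.isPullback_projMap'` (any algebra), `IsPullback.paste_horiz`, Mathlib `Proj.map_comp`.
STATED FOR A GENERIC `B` ON PURPOSE: a freshly elaborated `homogeneousSubmodule _ (Localization.Away (N : ℤ))` does not typecheck under `Proj`
(instance path `OreLocalization.instSemiring` vs `Ring.toSemiring` for `Submodule.addSubgroupClass` — kernel probe res-L1-w45b-stub-2 g21),
whereas instantiating a `B`-generic statement at `B := Localization.Away (N : ℤ)` (as ✓ `DescDoor` does with `DescDoorOver`) is fine. [OURS · counted 0] -/
theorem squares_of_base {B O k : Type} [CommRing B] [CommRing O] [CommRing k] (η : B →+* O) (π : O →+* k)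
    (hπ : Function.Surjective π) (n : ℕ) :
    letI := MvPolynomial.gradedAlgebra (σ := Fin (n + 1)) (R := B)
    letI := MvPolynomial.gradedAlgebra (σ := Fin (n + 1)) (R := O)
    letI := MvPolynomial.gradedAlgebra (σ := Fin (n + 1)) (R := k)
    ∀ (φ : homogeneousSubmodule (Fin (n + 1)) O →+*ᵍ homogeneousSubmodule (Fin (n + 1)) k)
    (hφ' : HomogeneousIdeal.irrelevant (homogeneousSubmodule (Fin (n + 1)) k) ≤
      (HomogeneousIdeal.irrelevant (homogeneousSubmodule (Fin (n + 1)) O)).map φ),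
    (∀ s, φ s = MvPolynomial.map π s) →
    ∃ (ψ : homogeneousSubmodule (Fin (n + 1)) B →+*ᵍ homogeneousSubmodule (Fin (n + 1)) k)
      (hψ' : HomogeneousIdeal.irrelevant (homogeneousSubmodule (Fin (n + 1)) k) ≤
        (HomogeneousIdeal.irrelevant (homogeneousSubmodule (Fin (n + 1)) B)).map ψ)
      (χ : homogeneousSubmodule (Fin (n + 1)) B →+*ᵍ homogeneousSubmodule (Fin (n + 1)) O)
      (hχ' : HomogeneousIdeal.irrelevant (homogeneousSubmodule (Fin (n + 1)) O) ≤
        (HomogeneousIdeal.irrelevant (homogeneousSubmodule (Fin (n + 1)) B)).map χ),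
      (∀ t, ψ t = MvPolynomial.map (π.comp η) t) ∧ (∀ t, χ t = MvPolynomial.map η t) ∧
      (Proj.map ψ hψ' : Proj (homogeneousSubmodule (Fin (n + 1)) k) ⟶ Proj (homogeneousSubmodule (Fin (n + 1)) B)) =
        Proj.map φ hφ' ≫ Proj.map χ hχ' ∧
      IsPullback (Proj.map φ hφ')
        (Proj.toSpecZero (homogeneousSubmodule (Fin (n + 1)) k) ≫
          Spec.map (CommRingCat.ofHom (algebraMap k (homogeneousSubmodule (Fin (n + 1)) k 0))))
        (Proj.toSpecZero (homogeneousSubmodule (Fin (n + 1)) O) ≫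
          Spec.map (CommRingCat.ofHom (algebraMap O (homogeneousSubmodule (Fin (n + 1)) O 0))))
        (Spec.map (CommRingCat.ofHom π)) ∧
      IsPullback (Proj.map χ hχ')
        (Proj.toSpecZero (homogeneousSubmodule (Fin (n + 1)) O) ≫
          Spec.map (CommRingCat.ofHom (algebraMap O (homogeneousSubmodule (Fin (n + 1)) O 0))))
        (Proj.toSpecZero (homogeneousSubmodule (Fin (n + 1)) B) ≫
          Spec.map (CommRingCat.ofHom (algebraMap B (homogeneousSubmodule (Fin (n + 1)) B 0))))
        (Spec.map (CommRingCat.ofHom η)) ∧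
      IsPullback (Proj.map ψ hψ')
        (Proj.toSpecZero (homogeneousSubmodule (Fin (n + 1)) k) ≫
          Spec.map (CommRingCat.ofHom (algebraMap k (homogeneousSubmodule (Fin (n + 1)) k 0))))
        (Proj.toSpecZero (homogeneousSubmodule (Fin (n + 1)) B) ≫
          Spec.map (CommRingCat.ofHom (algebraMap B (homogeneousSubmodule (Fin (n + 1)) B 0))))
        (Spec.map (CommRingCat.ofHom (π.comp η))) := by
  classical
  letI := MvPolynomial.gradedAlgebra (σ := Fin (n + 1)) (R := B)
  letI := MvPolynomial.gradedAlgebra (σ := Fin (n + 1)) (R := O)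
  letI := MvPolynomial.gradedAlgebra (σ := Fin (n + 1)) (R := k)
  intro φ hφ' hφ
  letI : Algebra B O := η.toAlgebra
  have halg : algebraMap B O = η := RingHom.algebraMap_toAlgebra η
  -- `χ := mapGraded B O`, `ψ := φ ∘ χ`
  set χ := ProjBaseChangeRing.mapGraded B O (Fin (n + 1)) with hχdef
  have hχ' := ProjBaseChangeRing.irrelevant_le_map B O (Fin (n + 1))
  have hχ : ∀ t, χ t = MvPolynomial.map η t := fun t => by
    rw [hχdef, ProjBaseChangeRing.mapGraded_apply, halg]
  have hψ' := HomogeneousIdeal.irrelevant_le_map_comp hχ' hφ'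
  have hψ : ∀ t, (φ.comp χ) t = MvPolynomial.map (π.comp η) t := fun t => by
    rw [GradedRingHom.comp_apply, hχ, hφ, MvPolynomial.map_map]
  -- the squares
  have hsqφ := ProjectiveAmbientFibre.isPullback_projMap π φ hφ hπ hφ'
  have hsqχ : IsPullback (Proj.map χ hχ')
      (Proj.toSpecZero (homogeneousSubmodule (Fin (n + 1)) O) ≫
        Spec.map (CommRingCat.ofHom (algebraMap O (homogeneousSubmodule (Fin (n + 1)) O 0))))
      (Proj.toSpecZero (homogeneousSubmodule (Fin (n + 1)) B) ≫
        Spec.map (CommRingCat.ofHom (algebraMap B (homogeneousSubmodule (Fin (n + 1)) B 0))))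
      (Spec.map (CommRingCat.ofHom η)) := by
    have h := ProjBaseChangeRing.isPullback_projMap' B O (n := n)
    rw [halg] at h
    exact h
  have hcomp : Proj.map (φ.comp χ) hψ' = Proj.map φ hφ' ≫ Proj.map χ hχ' := Proj.map_comp χ φ hχ' hφ'
  have hSpec : Spec.map (CommRingCat.ofHom π) ≫ Spec.map (CommRingCat.ofHom η) =
      Spec.map (CommRingCat.ofHom (π.comp η)) := by
    rw [← Spec.map_comp, ← CommRingCat.ofHom_comp]
  have hsqψ : IsPullback (Proj.map (φ.comp χ) hψ')
      (Proj.toSpecZero (homogeneousSubmodule (Fin (n + 1)) k) ≫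
        Spec.map (CommRingCat.ofHom (algebraMap k (homogeneousSubmodule (Fin (n + 1)) k 0))))
      (Proj.toSpecZero (homogeneousSubmodule (Fin (n + 1)) B) ≫
        Spec.map (CommRingCat.ofHom (algebraMap B (homogeneousSubmodule (Fin (n + 1)) B 0))))
      (Spec.map (CommRingCat.ofHom (π.comp η))) := by
    rw [hcomp, ← hSpec]
    exact hsqφ.paste_horiz hsqχ
  exact ⟨φ.comp χ, hψ', χ, hχ', hψ, hχ, hcomp, hsqφ, hsqχ, hsqψ⟩

/-- ★ **(E0)+(E1) FOR THE ENGINE, one call.** For `(N : k) ≠ 0`: the Witt base `(O, π)` of `exists_base` together with a ring map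
`η : ℤ[1/N] →+* O` through which EVERY `θ : ℤ[1/N] →+* k` is `π ∘ η` (maps out of a localisation of `ℤ` are unique), so that
`squares_of_base η π` serves `DescDoorOver ℤ[1/N]`'s `∀ θ` at the one θ there is. [OURS · counted 0] -/
theorem exists_base' (p : ℕ) (hp : p.Prime) (k : Type) [Field k] [CharP k p] [IsAlgClosed k] (N : ℕ) (hN : (N : k) ≠ 0) :
    ∃ (O : Type) (_ : CommRing O) (_ : IsDomain O) (_ : IsDiscreteValuationRing O) (_ : CharZero O)
      (_ : IsAdicComplete (maximalIdeal O) O) (_ : IsAlgClosed (ResidueField O)) (π : O →+* k),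
      Function.Surjective π ∧ RingHom.ker π = maximalIdeal O ∧ IsUnit (N : O) ∧
      ∃ η : Localization.Away (N : ℤ) →+* O, ∀ θ : Localization.Away (N : ℤ) →+* k, π.comp η = θ := by
  obtain ⟨O, i1, i2, i3, i4, i5, i6, π, hπ, hker, hunit, -⟩ := exists_base p hp k N hN
  have hunit' : IsUnit (algebraMap ℤ O (N : ℤ)) := by simpa using hunit
  refine ⟨O, i1, i2, i3, i4, i5, i6, π, hπ, hker, hunit, IsLocalization.Away.lift (N : ℤ) hunit', fun θ => ?_⟩
  refine IsLocalization.ringHom_ext (Submonoid.powers (N : ℤ)) ?_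
  exact Subsingleton.elim _ _

end Summit.ResolutionOfSingularities.ResolutionOfSingularities.Cruxes.EquisingularLiftNat.Sections.DescBase

end
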